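import Mathlib

/-!
# B4RoadGate — arithmetic half of the BOX-4 display-road verdict (plan-lens-HodgeAV-embed-2 g0, next room)

Frame: `P = B₄ × B̄₄`, BOX-4 alphabet (689 letters), Weil functional `λ`.  CLASS LAW (d2-γ, exact HNF of the clean
integer class lattice Λ): `λ = 16(1+i)μ`, `μ = a + b i ∈ ℤ[i]`, so `(Re λ, Im λ) = (16(a-b), 16(a+b))`.
RANK-4 GATE LAW (pen, Newton identities with `e₅ = e₆ = e₇ = 0`, `∫c₈ = 40320 e₈ + 36|λ|² = 0`):
`Q₈ = F(e₁,…,e₄) + |λ|²/140` with `F ∈ ℤ[1/6]` and `Q₈ ∈ ℤ`, hence `35 ∣ |λ|²/512 = a² + b²`.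
This file kernel-checks the finite arithmetic consequence used by the road verdict:
`35 ∣ a²+b²`, `(a,b) ≠ 0` ⇒ `max(|a-b|,|a+b|) ≥ 21`, i.e. `max(|Re λ|,|Im λ|) ≥ 336`, and `272 < 336`
(272 = the certified LP bound on `max(|Re λ|,|Im λ|)` under the rank-count caps; see the memo
`B4-DISPLAY-ROAD-embed2-g0.md`).  Nothing here is a statement about HC / HC_AV / 18881 / H2.
-/

namespace Summit.HodgeConjecture.HodgeConjecture.Cruxes.BlochSeedDiscOne.B4RoadGate

/-- Bounded form: for `|a|,|b| ≤ 20` the only pair with `35 ∣ a²+b²` and `max(|a-b|,|a+b|) ≤ 20` is `(0,0)`.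
(If `max(|a-b|,|a+b|) ≤ 20` then automatically `|a|,|b| ≤ 20`, so the bounded form is the general one.) -/
theorem sup_norm_law :
    ∀ a ∈ Finset.Icc (-20 : ℤ) 20, ∀ b ∈ Finset.Icc (-20 : ℤ) 20,
      (35 : ℤ) ∣ a ^ 2 + b ^ 2 → max |a - b| |a + b| ≤ 20 → a = 0 ∧ b = 0 := by
  decide +kernel

/-- The reduction `max(|a-b|,|a+b|) ≤ 20 → |a| ≤ 20 ∧ |b| ≤ 20` (so `sup_norm_law` covers all integers). -/
theorem box_of_sup (a b : ℤ) (h : max |a - b| |a + b| ≤ 20) : |a| ≤ 20 ∧ |b| ≤ 20 := by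
  have h1 : |a - b| ≤ 20 := le_trans (le_max_left _ _) h
  have h2 : |a + b| ≤ 20 := le_trans (le_max_right _ _) h
  constructor
  · have : |a + a| ≤ 40 := by
      calc |a + a| = |(a - b) + (a + b)| := by ring_nf
        _ ≤ |a - b| + |a + b| := abs_add_le _ _
        _ ≤ 40 := by linarith
    rw [abs_le] at this ⊢; constructor <;> linarith [this.1, this.2]
  · have : |b + b| ≤ 40 := by
      calc |b + b| = |(a + b) - (a - b)| := by ring_nf
        _ ≤ |a + b| + |a - b| := abs_sub _ _
        _ ≤ 40 := by linarith
    rw [abs_le] at this ⊢; constructor <;> linarith [this.1, this.2]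

/-- General form of the rank-4 gate sup-norm law on `μ = a+bi`: `35 ∣ a²+b²`, `(a,b) ≠ (0,0)` ⇒ `max(|a-b|,|a+b|) ≥ 21`,
i.e. `max(|Re λ|,|Im λ|) = 16·max(|a-b|,|a+b|) ≥ 336`. -/
theorem gate_sup_norm (a b : ℤ) (hdiv : (35 : ℤ) ∣ a ^ 2 + b ^ 2) (hne : ¬ (a = 0 ∧ b = 0)) :
    21 ≤ max |a - b| |a + b| := by
  by_contra hlt
  push_neg at hlt
  have hle : max |a - b| |a + b| ≤ 20 := by omega
  obtain ⟨ha, hb⟩ := box_of_sup a b hle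
  have ha' : a ∈ Finset.Icc (-20 : ℤ) 20 := by rw [Finset.mem_Icc]; exact abs_le.mp ha
  have hb' : b ∈ Finset.Icc (-20 : ℤ) 20 := by rw [Finset.mem_Icc]; exact abs_le.mp hb
  exact hne (sup_norm_law a ha' b hb' hdiv hle)

/-- The minimum 336 is attained: `μ = 2 + i·(-1)`… concretely `(a,b) = (14,7)`: `35 ∣ 245`, `λ = (112, 336)`. -/
theorem gate_sup_norm_attained : (35 : ℤ) ∣ 14 ^ 2 + 7 ^ 2 ∧ max |(14 : ℤ) - 7| |14 + 7| = 21 ∧ 16 * 21 = (336 : ℤ) := by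
  refine ⟨⟨7, by norm_num⟩, by norm_num [abs_of_nonneg], by norm_num⟩

/-- The certified LP bound (rank-count caps) sits strictly below the gate law: `272 < 336`; and the refined-cap bound `96 < 336`. -/
theorem road_gap : (272 : ℤ) < 16 * 21 ∧ (96 : ℤ) < 16 * 21 := by norm_num

/-- On the slice S0 the law is sharper (d2-γ): `|λ|² = 140·Q₈`, `48 ∣ Q₈` force `|λ|² ≥ 1128960`; consistency: `1128960 = 512·2205`, `35 ∣ 2205`. -/
theorem s0_consistency : (1128960 : ℤ) = 512 * 2205 ∧ (35 : ℤ) ∣ 2205 ∧ (125440 : ℤ) = 512 * 245 ∧ 245 = 35 * 7 := by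
  refine ⟨by norm_num, ⟨63, by norm_num⟩, by norm_num, by norm_num⟩

end Summit.HodgeConjecture.HodgeConjecture.Cruxes.BlochSeedDiscOne.B4RoadGate
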